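import Literature.NumberTheory.LocalFields.EquivariantUnitRigidity
import Mathlib.Topology.Algebra.Valued.NormedValued
import Mathlib.Topology.Algebra.Valued.ValuativeRel
import Mathlib.NumberTheory.Padics.ProperSpace
import Mathlib.Analysis.Normed.Module.FiniteDimension
import HarnessLib

/-!
# Kummer rigidity in NORM currency: locally compact ultrametric normed fields, finite extensions of `ℚ_p`

PROOF-ONLY junction file (no definition, no instance declared, no named fact) making
`EquivariantUnitRigidity.lean` consumable for a base field given as a NORMED field — the currency of
the abc-iut cell's `GaloisValDatum.ofComplete p k` (`k` a complete ultrametric normed field, finite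
over `ℚ_p`, valuative relation `ValuativeRel.ofValuation NormedField.valuation`):

* `isValuativeTopology_of_normedField` — for a non-trivially normed ultrametric field `k`, the metric
  topology IS the valuative topology of `ValuativeRel.ofValuation NormedField.valuation` (balls
  `{‖x‖ < ε}` and `{v x < γ}` are cofinal at `0`; pattern of the tree's `ℚ_[p]` proof
  `GaloisRepresentations.Padic.isValuativeTopology`). Serre, *Local Fields*, Ch. II §1.
* `isNonarchimedeanLocalField_of_normedField` — if moreover `k` is locally compact, `k` is a
  non-archimedean local field in Mathlib's sense (`IsNonarchimedeanLocalField`) for that valuative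
  relation (Serre, Ch. II §1, Prop. 1); `isNonarchimedeanLocalField_of_finiteDimensional_padic` — in
  particular every normed `ℚ_p`-algebra field finite-dimensional over `ℚ_p` (Mathlib
  `FiniteDimensional.proper` + `Padic.instProperSpace`).
* `eq_one_of_forall_exists_pow_eq_of_normedField` / `_of_finiteDimensional_padic` —
  **`⋂ₙ (kˣ)ⁿ = {1}`** for such `k` (Neukirch, ANT, Ch. II Prop. (5.7)), instance-free statement.
* `map_algebraMap_eq_self_of_norm` / `_of_finiteDimensional_padic` / `_of_isAlgClosure_padic` —
  **Kummer rigidity** (Neukirch, Ch. IV §3 + Ch. II (5.7)): `L/k` Galois with enough roots (resp. an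
  algebraic closure of `k`), `v` a valuation on `L` with `v c ≤ v d ↔ ‖c‖ ≤ ‖d‖` on `k`; every
  `Aut(L/k)`-equivariant `v`-preserving multiplicative `C : L →*₀ L` fixes `k` pointwise.

Written for the abc-iut cell (seat abc-iut-w4-d014 gen 8), row (E3) of L5-lead RULINGS #80 for
[IUTchI] Ex. 3.3 (iii)(e): the consumer's `k` carries a norm, not an `IsNonarchimedeanLocalField`
instance; this file bridges the two. Nothing here concerns [IUTchIII]; no side is taken on any
disputed claim.
-/

noncomputable section

namespace Literature.NumberTheory.LocalFields

open ValuativeRel Filter Topology Set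

section Normed

variable (k : Type*) [NontriviallyNormedField k] [IsUltrametricDist k]

/-- **The metric topology of a non-trivially normed ultrametric field is the valuative topology** of
the valuative relation of its norm (`ValuativeRel.ofValuation NormedField.valuation`): a set is a
neighbourhood of `0` iff it contains some `{x | v x < γ}`. The sets `{v x < v a}` (`a ≠ 0`) are the
balls `{‖x‖ < ‖a‖}`, every unit `γ` of the value group is a value `v a`, and since the norm is
non-trivial there are `a ≠ 0` of arbitrarily small norm. [cite: SerreLocalFields1979, Ch. II §1] -/
theorem isValuativeTopology_of_normedField :
    @IsValuativeTopology k _ (ValuativeRel.ofValuation (NormedField.valuation (K := k))) _ := by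
  letI : ValuativeRel k := ValuativeRel.ofValuation (NormedField.valuation (K := k))
  haveI : (NormedField.valuation (K := k)).Compatible := .ofValuation _
  refine IsValuativeTopology.of_zero fun s ↦ ?_
  rw [Metric.nhds_basis_ball.mem_iff]
  constructor
  · rintro ⟨ε, hε, hsub⟩
    obtain ⟨a, ha0, haε⟩ := NormedField.exists_norm_lt k hε
    have ha0' : a ≠ 0 := norm_pos_iff.mp ha0
    have hva : valuation k a ≠ 0 := (map_ne_zero _).mpr ha0'
    refine ⟨Units.mk0 _ hva, fun x hx ↦ hsub ?_⟩
    have hx' : x <ᵥ a := (Valuation.vlt_iff_lt (valuation k)).mpr hx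
    have hlt : NormedField.valuation x < NormedField.valuation a :=
      (Valuation.vlt_iff_lt (NormedField.valuation (K := k))).mp hx'
    rw [NormedField.valuation_apply, NormedField.valuation_apply] at hlt
    rw [mem_ball_zero_iff]
    calc ‖x‖ < ‖a‖ := by exact_mod_cast hlt
      _ < ε := haε
  · rintro ⟨γ, hγ⟩
    obtain ⟨a, ha⟩ := valuation_surjective (γ : ValueGroupWithZero k)
    have ha0 : a ≠ 0 := by
      rintro rfl
      exact γ.ne_zero (by simpa using ha.symm)
    refine ⟨‖a‖, norm_pos_iff.mpr ha0, fun x hx ↦ hγ ?_⟩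
    rw [mem_ball_zero_iff] at hx
    have hlt : NormedField.valuation x < NormedField.valuation a := by
      rw [NormedField.valuation_apply, NormedField.valuation_apply]
      exact_mod_cast hx
    have hx' : x <ᵥ a := (Valuation.vlt_iff_lt (NormedField.valuation (K := k))).mpr hlt
    show valuation k x < γ
    rw [← ha]
    exact (Valuation.vlt_iff_lt (valuation k)).mp hx'

/-- **A locally compact non-trivially normed ultrametric field is a non-archimedean local field** in
Mathlib's sense (`IsNonarchimedeanLocalField`: valuative topology, locally compact, non-trivially
valued) for the valuative relation of its norm. A theorem, not an instance (the valuative relation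
is not registered globally on normed fields). [cite: SerreLocalFields1979, Ch. II §1] -/
theorem isNonarchimedeanLocalField_of_normedField [LocallyCompactSpace k] :
    @IsNonarchimedeanLocalField k _ (ValuativeRel.ofValuation (NormedField.valuation (K := k))) _ := by
  letI : ValuativeRel k := ValuativeRel.ofValuation (NormedField.valuation (K := k))
  haveI : (NormedField.valuation (K := k)).Compatible := .ofValuation _
  haveI : IsValuativeTopology k := isValuativeTopology_of_normedField k
  haveI : IsNontrivial k := by
    obtain ⟨a, ha0, ha1⟩ := NormedField.exists_norm_lt k one_pos
    have ha0' : a ≠ 0 := norm_pos_iff.mp ha0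
    refine ⟨valuation k a, (map_ne_zero _).mpr ha0', ?_⟩
    intro h
    have hle : valuation k 1 ≤ valuation k a := by rw [map_one, h]
    rw [← Valuation.vle_iff_le (valuation k), Valuation.vle_iff_le (NormedField.valuation (K := k)),
      NormedField.valuation_apply, NormedField.valuation_apply, nnnorm_one] at hle
    have : (1 : ℝ) ≤ ‖a‖ := by exact_mod_cast hle
    exact absurd ha1 (not_lt.mpr this)
  exact {}

/-- A normed `ℚ_p`-algebra field of finite dimension over `ℚ_p` is locally compact (Mathlib
`FiniteDimensional.proper` over the proper space `ℚ_[p]`), hence a non-archimedean local field for the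
valuative relation of its norm. [cite: SerreLocalFields1979, Ch. II §1] -/
theorem isNonarchimedeanLocalField_of_finiteDimensional_padic (p : ℕ) [Fact p.Prime]
    [NormedAlgebra ℚ_[p] k] [FiniteDimensional ℚ_[p] k] :
    @IsNonarchimedeanLocalField k _ (ValuativeRel.ofValuation (NormedField.valuation (K := k))) _ := by
  haveI : ProperSpace k := FiniteDimensional.proper ℚ_[p] k
  exact isNonarchimedeanLocalField_of_normedField k

variable {k}

/-- **`⋂ₙ (kˣ)ⁿ = {1}` in a locally compact non-trivially normed ultrametric field** (= a
non-archimedean local field): an element `u ≠ 0` admitting an `n`-th root in `k` for every `n ≥ 1`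
equals `1`. Instance-free statement; proof via `eq_one_of_forall_exists_pow_eq` and
`isNonarchimedeanLocalField_of_normedField`. [cite: NeukirchANT1999, Ch. II Prop. 5.7] -/
theorem eq_one_of_forall_exists_pow_eq_of_normedField [LocallyCompactSpace k] {u : k} (hu : u ≠ 0)
    (h : ∀ n : ℕ, 0 < n → ∃ w : k, w ^ n = u) : u = 1 := by
  letI : ValuativeRel k := ValuativeRel.ofValuation (NormedField.valuation (K := k))
  haveI : IsNonarchimedeanLocalField k := isNonarchimedeanLocalField_of_normedField k
  exact eq_one_of_forall_exists_pow_eq hu h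

/-- `⋂ₙ (kˣ)ⁿ = {1}` for a normed `ℚ_p`-algebra field `k` finite-dimensional over `ℚ_p` (e.g. the
completion `K_v` of a number field at `v ∣ p`, or any finite extension of `ℚ_p` with its `p`-adic
norm). [cite: NeukirchANT1999, Ch. II Prop. 5.7] -/
theorem eq_one_of_forall_exists_pow_eq_of_finiteDimensional_padic (p : ℕ) [Fact p.Prime]
    [NormedAlgebra ℚ_[p] k] [FiniteDimensional ℚ_[p] k] {u : k} (hu : u ≠ 0)
    (h : ∀ n : ℕ, 0 < n → ∃ w : k, w ^ n = u) : u = 1 := by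
  haveI : ProperSpace k := FiniteDimensional.proper ℚ_[p] k
  exact eq_one_of_forall_exists_pow_eq_of_normedField hu h

end Normed

section Rigidity

variable {k L : Type*} [NontriviallyNormedField k] [IsUltrametricDist k]
variable [Field L] [Algebra k L]
variable {Γ₀ : Type*} [LinearOrderedCommGroupWithZero Γ₀]

/-- **Kummer rigidity over a locally compact ultrametric normed field (norm currency).** `L/k`
Galois containing `n`-th roots of all elements of `k` for all `n ≥ 1`, `v` a valuation on `L`
COMPARING LIKE THE NORM on `k` (`v c ≤ v d ↔ ‖c‖ ≤ ‖d‖`, e.g. `v` = the unique extension of `‖·‖`),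
`C : L →*₀ L` multiplicative, commuting with every `σ ∈ Aut(L/k)` and preserving `v`. Then `C`
fixes `k` pointwise. [cite: NeukirchANT1999, Ch. IV §3] -/
theorem map_algebraMap_eq_self_of_norm [LocallyCompactSpace k] [IsGalois k L] (v : Valuation L Γ₀)
    (hcompat : ∀ c d : k, v (algebraMap k L c) ≤ v (algebraMap k L d) ↔ ‖c‖ ≤ ‖d‖)
    (C : L →*₀ L) (hC : ∀ (σ : L ≃ₐ[k] L) (x : L), C (σ x) = σ (C x))
    (hv : ∀ x : L, v (C x) = v x)
    (hroots : ∀ n : ℕ, 0 < n → ∀ a : k, ∃ x : L, x ^ n = algebraMap k L a)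
    (a : k) : C (algebraMap k L a) = algebraMap k L a := by
  letI : ValuativeRel k := ValuativeRel.ofValuation (NormedField.valuation (K := k))
  haveI : (NormedField.valuation (K := k)).Compatible := .ofValuation _
  haveI : IsNonarchimedeanLocalField k := isNonarchimedeanLocalField_of_normedField k
  refine map_algebraMap_eq_self_of_isEquiv v (fun c d => ?_) C hC hv hroots a
  rw [Valuation.comap_apply, Valuation.comap_apply, hcompat,
    ← Valuation.vle_iff_le (valuation k), Valuation.vle_iff_le (NormedField.valuation (K := k)),
    NormedField.valuation_apply, NormedField.valuation_apply]
  exact ⟨fun h => by exact_mod_cast h, fun h => by exact_mod_cast h⟩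

/-- **Kummer rigidity over a finite extension of `ℚ_p` (norm currency).** As
`map_algebraMap_eq_self_of_norm` for `k` a normed `ℚ_p`-algebra field finite-dimensional over `ℚ_p`
(locally compact by Mathlib `FiniteDimensional.proper`). [cite: NeukirchANT1999, Ch. IV §3] -/
theorem map_algebraMap_eq_self_of_finiteDimensional_padic (p : ℕ) [Fact p.Prime]
    [NormedAlgebra ℚ_[p] k] [FiniteDimensional ℚ_[p] k] [IsGalois k L] (v : Valuation L Γ₀)
    (hcompat : ∀ c d : k, v (algebraMap k L c) ≤ v (algebraMap k L d) ↔ ‖c‖ ≤ ‖d‖)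
    (C : L →*₀ L) (hC : ∀ (σ : L ≃ₐ[k] L) (x : L), C (σ x) = σ (C x))
    (hv : ∀ x : L, v (C x) = v x)
    (hroots : ∀ n : ℕ, 0 < n → ∀ a : k, ∃ x : L, x ^ n = algebraMap k L a)
    (a : k) : C (algebraMap k L a) = algebraMap k L a := by
  haveI : ProperSpace k := FiniteDimensional.proper ℚ_[p] k
  exact map_algebraMap_eq_self_of_norm v hcompat C hC hv hroots a

/-- **Kummer rigidity for the algebraic closure of a finite extension of `ℚ_p` (norm currency).**
`k` a normed `ℚ_p`-algebra field finite-dimensional over `ℚ_p` (characteristic `0` is automatic),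
`L` an algebraic closure of `k` (Galois; all roots exist), `v` a valuation on `L` comparing like the
norm on `k` — e.g. the spectral-norm valuation of `k̄`, the abc-iut cell's `GaloisValDatum.ofComplete`.
Every `Gal(L/k)`-equivariant `v`-preserving multiplicative `C : L →*₀ L` fixes `k` pointwise; in
particular `C p = p`. [cite: NeukirchANT1999, Ch. IV §3] -/
theorem map_algebraMap_eq_self_of_isAlgClosure_padic (p : ℕ) [Fact p.Prime]
    [NormedAlgebra ℚ_[p] k] [FiniteDimensional ℚ_[p] k] [IsAlgClosure k L] (v : Valuation L Γ₀)
    (hcompat : ∀ c d : k, v (algebraMap k L c) ≤ v (algebraMap k L d) ↔ ‖c‖ ≤ ‖d‖)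
    (C : L →*₀ L) (hC : ∀ (σ : L ≃ₐ[k] L) (x : L), C (σ x) = σ (C x))
    (hv : ∀ x : L, v (C x) = v x) (a : k) :
    C (algebraMap k L a) = algebraMap k L a := by
  haveI : CharZero k := charZero_of_injective_algebraMap (algebraMap ℚ_[p] k).injective
  haveI : IsAlgClosed L := IsAlgClosure.isAlgClosed k
  haveI : IsGalois k L := IsAlgClosure.isGalois k L
  exact map_algebraMap_eq_self_of_finiteDimensional_padic p v hcompat C hC hv
    (fun n hn b => IsAlgClosed.exists_pow_nat_eq _ hn) a

end Rigidity

end Literature.NumberTheory.LocalFields
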